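import Summits.BirchSwinnertonDyer.BirchSwinnertonDyer.Theorems.CycTangentCMCycTangentBoundFrameUniquenessCM
import Summits.BirchSwinnertonDyer.BirchSwinnertonDyer.Theorems.CycTangentCMCycTangentBoundSelfDualCharacter
import Summits.BirchSwinnertonDyer.BirchSwinnertonDyer.Theorems.CycTangentCMCycTangentBoundSignLemma
import HarnessLib

set_option linter.dupNamespace false
set_option autoImplicit false

/-!
# Crux `CycTangentCM.CycTangentBound` (stmt-BirchSwinnertonDyer-22628), stub `stub_selfDual`:
# THE SELF-DUAL FUNCTIONAL EQUATION (SD) FROM THE TYPED de Shalit II.6.4 — at unit `p`-adic periods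

Seat `bsd-line-ctcm-p2` (line `tangent-cone-parity`, lead `bsd-line-ctcm-p1`). The registered stub
`stub_selfDual` is VERBATIM the cite-only fact `DeShalit1987.thmII64_selfDual_functionalEquation_cm`
(p585725), which bundles beyond the tree's typed `DeShalit1987.thmII64_katzMeasure₂_functionalEquation`
(a) the self-duality `reflect ψ⁻¹ = ψ⁻¹`, `c • S = S`, (b) the uniqueness of the frame (`Ǧ = G`),
(c) the sign `C = ±1` (II.6.5 (18)) and (d) the extension from `Ω_p ∈ R₀ˣ` to all `Ω_p ≠ 0`. This file
DERIVES (SD) from the typed II.6.4 on its own range (d′) `Ω_p ∈ R₀ˣ`, with (a) from the cite-only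
Deuring fact (p588890), (b) the kernel uniqueness theorem `isKatzMeasure₂_unique_of_cm` and (c) the
kernel sign lemma `exists_sign_of_selfRelation` (p590308):

* `selfDual_of_thmII64` — GRANTED `thmII64_katzMeasure₂_functionalEquation` AND
  `Deuring_exists_heckeCharacter_of_maximalCM` (both cite-only inputs of the route): for the crux's data
  (`A` maximal-CM, `p ≥ 5` split, `ψ` of type `(1,0)` with `L(ψ,s) = L(A,s)`, exact modulus `S`, a
  generator pair, `Ω ≠ 0`, `δ² = ±d_K`) and a UNIT `p`-adic period `Ω_p ∈ R₀ˣ`, every frame `G` of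
  `IsKatzMeasure₂ … ψ⁻¹ Ω δ Ω_p` satisfies the conclusion of `stub_selfDual`:
  `∃ w ∈ {1,−1}, g, ∀ (r, r₂) conjugate-inverse through the pair, G(P r₂) = x → G(P r) = w·r(g)·x`.

WHAT THIS DOES NOT GIVE: the stub quantifies over ALL `Ω_p ≠ 0`; II.6.4 as typed speaks at `Ω_p ∈ R₀ˣ`
only, and the transport to an arbitrary `Ω_p` (where a frame with a unit coefficient should not exist
unless `Ω_p/Ω_p⁰` is an analytic character) is a `p`-adic-analytic rigidity statement absent from the
tree. THEOREMS ONLY (no `def`, no fact, no `sorry`); conditional on the two cite-only facts, displayed as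
hypotheses; supports, does not close, stmt-BirchSwinnertonDyer-22628. BSD is not proved by this.

References: [deShalit1987] II.6.4 Theorem (i) (9), (13)–(15), II.6.5 (18), II.1.4; [SilvermanATAEC1994]
Ch. II Thm. 10.5.
-/

noncomputable section

open scoped NumberField Classical
open NumberField IsDedekindDomain Field
open Literature Literature.NumberTheory.GaloisRepresentations Literature.NumberTheory.EllipticCurves
open Summit.BirchSwinnertonDyer.BirchSwinnertonDyer.Theorems.CycTangentCMCycTangentBoundFrameUniquenessCM
open Summit.BirchSwinnertonDyer.BirchSwinnertonDyer.Theorems.CycTangentCMCycTangentBoundSelfDualCharacter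
open Summit.BirchSwinnertonDyer.BirchSwinnertonDyer.Theorems.CycTangentCMCycTangentBoundSignLemma

namespace Summit.BirchSwinnertonDyer.BirchSwinnertonDyer.Theorems.CycTangentCMCycTangentBoundSelfDualOfThmII64

/-- **(SD) from the typed de Shalit II.6.4, at unit `p`-adic periods.** See the module docstring.
[cite: deShalit1987, II.6.4 Theorem (i) (9), (13)–(15) (store chunk 84–85) and II.6.5 (18) (store chunk 86)]
[cite: SilvermanATAEC1994, Ch. II Thm. 10.5 (b)] -/
theorem selfDual_of_thmII64 (hF : DeShalit1987.thmII64_katzMeasure₂_functionalEquation)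
    (hD : Deuring_exists_heckeCharacter_of_maximalCM)
    {A : WeierstrassCurve ℚ} [A.IsElliptic] [A.IsGloballyMinimal] {p : ℕ} [Fact p.Prime] (hp : 5 ≤ p)
    (hj : A.j ∈ maximalCMJInvariants) {K : Type} [Field K] [NumberField K] (hK : IsCMFieldOfJ K A.j)
    {ψ : HeckeCharacter K} (hψ : ψ.HasInfinityType (fun _ ↦ 1) (fun _ ↦ 0))
    (hL : ∀ s : ℂ, 3 / 2 < s.re → heckeLFunction ψ s = A.LSeries s)
    {ι : PadicAlgCl p ≃+* ℂ} {v vbar : HeightOneSpectrum (𝓞 K)}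
    (hv : ((p : ℕ) : 𝓞 K) ∈ v.asIdeal) (hvbar : ((p : ℕ) : 𝓞 K) ∈ vbar.asIdeal) (hne : vbar ≠ v)
    (hι : ∀ (w : InfinitePlace K) (k : 𝓞 K), k ∈ v.asIdeal ↔ ‖ι.symm (w.embedding (k : K))‖ < 1)
    {S : Finset (HeightOneSpectrum (𝓞 K))} (hvS : v ∉ S) (hvbS : vbar ∉ S)
    (hSram : ∀ w ∈ S, ¬ ψ.IsUnramifiedAt w)
    (hSunr : ∀ w : HeightOneSpectrum (𝓞 K), w ∉ S → ψ.IsUnramifiedAt w)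
    {κ₁ κ₂ : ZpExtension K p} {γ₁ γ₂ : absoluteGaloisGroup K}
    (hpair : ZpExtension.IsTopGeneratorPair κ₁ κ₂ γ₁ γ₂)
    {Ω δ : ℂ} (Ωp : (unrIntegers p)ˣ) (hΩ : Ω ≠ 0)
    (hδ : δ ^ 2 = (NumberField.discr K : ℂ) ∨ δ ^ 2 = -(NumberField.discr K : ℂ))
    {G : PowerSeries (PowerSeries (PadicComplexInt p))}
    (hG : IsKatzMeasure₂ ι v vbar S κ₁ κ₂ γ₁ γ₂ ψ⁻¹ Ω δ ((Ωp : unrIntegers p) : ℂ_[p]) G) :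
    ∃ (w : ℤ) (g : absoluteGaloisGroup K), (w = 1 ∨ w = -1) ∧
      ∀ (r r₂ : FramedGaloisRep K (PadicAlgCl p) 1),
        FactorsThroughPair κ₁ κ₂ r → FactorsThroughPair κ₁ κ₂ r₂ → IsConjInverse r r₂ →
        ∀ x : ℂ_[p],
          IntSeries.HasValueAt₂ G (avatarValueAt r₂ γ₁ - 1) (avatarValueAt r₂ γ₂ - 1) x →
          IntSeries.HasValueAt₂ G (avatarValueAt r γ₁ - 1) (avatarValueAt r γ₂ - 1)
            ((w : ℂ_[p]) * avatarValueAt r g * x) := by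
  have hKiq : IsImaginaryQuadratic K :=
    Deuring_exists_heckeCharacter_of_maximalCM.isImaginaryQuadratic hj hK
  haveI : IsCMField K := hKiq.isCMField
  have hp2 : p ≠ 2 := by omega
  -- the twist `λ = ψ⁻¹`
  have hlam : ψ⁻¹.IsAlgebraic :=
    (HeckeCharacter.isAlgebraic_iff_exists_hasInfinityType _).mpr ⟨_, _, hψ.inv⟩
  have hlamv : ψ⁻¹.IsUnramifiedAt v := (hSunr v hvS).inv'
  have hlamvbar : ψ⁻¹.IsUnramifiedAt vbar := (hSunr vbar hvbS).inv'
  have hprim : ∀ w ∈ S, ¬ ψ⁻¹.IsUnramifiedAt w := fun w hw h ↦ hSram w hw (by simpa using h.inv')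
  have hunr : ∀ w : HeightOneSpectrum (𝓞 K), w ∉ S → w ≠ v → w ≠ vbar → ψ⁻¹.IsUnramifiedAt w :=
    fun w hw _ _ ↦ (hSunr w hw).inv'
  -- de Shalit II.6.4 as typed
  obtain ⟨Gc, C, g, hGc, -, hrel⟩ := hF p K hKiq ι v vbar hv hvbar hne hι Ω δ Ωp hΩ hδ S hvS hvbS
    ψ⁻¹ hlam hlamv hlamvbar hprim hunr κ₁ κ₂ γ₁ γ₂ hpair.isUnitGeneratorPair G hG
  -- self-duality of the branch (Deuring): `Ǧ` is a frame of the SAME data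
  rw [image_complexConj_smul_eq_self hD hj hK hL hSram hSunr, reflect_inv_eq_inv hD hj hK hL] at hGc
  -- uniqueness of the frame: `Ǧ = G`
  have hGG : Gc = G := isKatzMeasure₂_unique_of_cm hKiq hp2 hv hvbar hne hι hψ hSunr hpair hGc hG
  subst hGG
  -- the sign
  exact exists_sign_of_selfRelation hKiq hpair hrel

end Summit.BirchSwinnertonDyer.BirchSwinnertonDyer.Theorems.CycTangentCMCycTangentBoundSelfDualOfThmII64

end
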